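import Mathlib

/-!
# Single-link resonance (S2c of line `corner-decorrelation-deep-hole`): a Remez-type doubling bound for
polynomials on short arcs of the unit circle

For a complex polynomial `Q` of degree `≤ m`, a point `t⋆` and an interval `J = [p, q] ∋ t⋆` of length
`≤ 1`, the set of `t ∈ J` with `‖Q(e^{it⋆})‖ ≤ e^{50m} ‖Q(e^{it})‖` has Lebesgue measure `≥ ¾ |J|`.
Proof by root factorisation `Q = c ∏ (X − z_k)`: `‖e^{it⋆} − z‖ ≤ ‖e^{it} − z‖ + |t − t⋆|`,
`1 + x ≤ e^{√x}`, so `‖Q(e^{it⋆})‖ ≤ ‖Q(e^{it})‖ · exp Σ_k √(|J| / ‖e^{it} − z_k‖)`; and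
`∫_J √(|J|/‖e^{it} − z_k‖) dt ≤ 9|J|` for every root (`‖e^{it} − z‖ ≥ ½‖e^{it} − e^{iα}‖ ≥ |t − α|/5` for a
suitable argument `α` of `z`), so by Markov the exceptional set has measure `≤ 9m|J|/(50m) < |J|/5`.
-/

namespace Summit.QuantumFields.QCD.Cruxes.WindowExtinction.CornerDecorrelationDeepHole

open scoped BigOperators Real
open MeasureTheory Complex Polynomial Set

/-! ### Elementary inequalities -/

/-- `1 + x ≤ exp (√x)` for `x ≥ 0` (with `u = √x`: `1 + u² ≤ 1 + u + u²/2 + u³/6 ≤ eᵘ`). -/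
theorem cornerSL_one_add_le_exp_sqrt {x : ℝ} (hx : 0 ≤ x) : 1 + x ≤ Real.exp (Real.sqrt x) := by
  set u := Real.sqrt x with hu
  have hu0 : 0 ≤ u := Real.sqrt_nonneg x
  have hx' : x = u ^ 2 := (Real.sq_sqrt hx).symm
  have hsum := Real.sum_le_exp_of_nonneg hu0 4
  simp only [Finset.sum_range_succ, Finset.sum_range_zero, Nat.factorial, Nat.cast_ofNat,
    pow_zero, pow_one, zero_add, Nat.cast_succ] at hsum
  rw [hx']
  nlinarith [sq_nonneg (u - 3 / 2), hsum, pow_nonneg hu0 3]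

/-- `‖e^{it} − e^{iα}‖ = 2 |sin ((t − α)/2)|`. -/
theorem cornerSL_norm_cexp_sub_cexp_eq (t α : ℝ) :
    ‖exp (t * I) - exp (α * I)‖ = 2 * |Real.sin ((t - α) / 2)| := by
  have h : exp (t * I) - exp (α * I) = exp (α * I) * (exp (I * (t - α : ℝ)) - 1) := by
    rw [mul_sub, mul_one, ← exp_add]
    congr 1
    push_cast
    ring_nf
  rw [h, norm_mul, norm_exp_ofReal_mul_I, one_mul, norm_exp_I_mul_ofReal_sub_one, Real.norm_eq_abs, abs_mul,
    abs_two]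

/-- **Half-angle comparison.**  For every `z ∈ ℂ` there is a phase `α` with
`‖e^{it} − e^{iα}‖ ≤ 2 ‖e^{it} − z‖` for all real `t` (`α = arg z`; the worst case is `z = 0`). -/
theorem cornerSL_half_angle (z : ℂ) : ∃ α : ℝ, ∀ t : ℝ, ‖exp (t * I) - exp (α * I)‖ ≤ 2 * ‖exp (t * I) - z‖ := by
  refine ⟨arg z, fun t => ?_⟩
  -- write `z = ρ e^{iα}` with `ρ = ‖z‖ ≥ 0`
  set α := arg z
  have hz : z = (‖z‖ : ℂ) * exp (α * I) := (norm_mul_exp_arg_mul_I z).symm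
  set ρ := ‖z‖ with hρ
  have hρ0 : 0 ≤ ρ := norm_nonneg z
  -- squared norms in terms of `c = cos (t − α)`
  have hsq1 : ‖exp (t * I) - exp (α * I)‖ ^ 2 = 2 - 2 * Real.cos (t - α) := by
    rw [cornerSL_norm_cexp_sub_cexp_eq, mul_pow, sq_abs, Real.sin_sq_eq_half_sub]
    ring_nf
  have hsq2 : ‖exp (t * I) - z‖ ^ 2 = 1 + ρ ^ 2 - 2 * ρ * Real.cos (t - α) := by
    rw [hz]
    have : exp (↑t * I) - ↑ρ * exp (↑α * I) = exp (α * I) * (exp (I * (t - α : ℝ)) - ρ) := by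
      rw [mul_sub, ← exp_add]
      congr 1
      · push_cast; ring_nf
      · ring
    rw [this, norm_mul, norm_exp_ofReal_mul_I, one_mul]
    rw [show I * ((t - α : ℝ) : ℂ) = ((t - α : ℝ) : ℂ) * I by ring, Complex.sq_norm, Complex.normSq_apply]
    simp only [sub_re, sub_im, exp_ofReal_mul_I_re, exp_ofReal_mul_I_im, ofReal_re, ofReal_im, sub_zero]
    nlinarith [Real.sin_sq_add_cos_sq (t - α)]
  have hc1 : Real.cos (t - α) ≤ 1 := Real.cos_le_one _
  have hc2 : -1 ≤ Real.cos (t - α) := Real.neg_one_le_cos _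
  have key : ‖exp (t * I) - exp (α * I)‖ ^ 2 ≤ (2 * ‖exp (t * I) - z‖) ^ 2 := by
    rw [mul_pow, hsq1, hsq2]
    nlinarith [sq_nonneg (ρ - Real.cos (t - α)), mul_nonneg hρ0 (by linarith : (0:ℝ) ≤ 1 - Real.cos (t - α))]
  exact (pow_le_pow_iff_left₀ (norm_nonneg _) (by positivity) two_ne_zero).1 key

/-- `|x| ≤ 5 |sin (x/2)|` for `|x| ≤ π + 1` (Jordan's inequality on `|x| ≤ π`, and `sin y ≥ 7/8` for
`y ∈ [π/2, (π+1)/2]`). -/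
theorem cornerSL_abs_le_five_mul_abs_sin_half {x : ℝ} (hx : |x| ≤ π + 1) : |x| ≤ 5 * |Real.sin (x / 2)| := by
  have hπ := Real.pi_gt_three
  have hπ' := Real.pi_lt_d2
  -- reduce to `y = |x| / 2 ≥ 0`
  have hsin : |Real.sin (x / 2)| = |Real.sin (|x| / 2)| := by
    rcases le_or_gt 0 x with h | h
    · rw [abs_of_nonneg h]
    · rw [abs_of_neg h, neg_div, Real.sin_neg, abs_neg]
  rw [hsin]
  set y := |x| / 2 with hy
  have hy0 : 0 ≤ y := by positivity
  have hxy : |x| = 2 * y := by rw [hy]; ring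
  rw [hxy]
  rcases le_or_gt y (π / 2) with h1 | h1
  · -- Jordan
    have hJ : 2 / π * |y| ≤ |Real.sin y| := Real.mul_abs_le_abs_sin (by rw [abs_of_nonneg hy0]; exact h1)
    rw [abs_of_nonneg hy0] at hJ
    have : 2 / π * y ≥ 2 / 5 * y := by
      apply mul_le_mul_of_nonneg_right _ hy0
      rw [div_le_div_iff₀ (by norm_num) (by positivity)]
      nlinarith
    nlinarith [abs_nonneg (Real.sin y)]
  · -- `y ∈ (π/2, (π+1)/2]`: `sin y = cos (y − π/2) ≥ 1 − (y − π/2)²/2 ≥ 7/8`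
    have hy1 : y - π / 2 ≤ 1 / 2 := by
      have : 2 * y ≤ π + 1 := hxy ▸ hx
      linarith
    have hcos : 1 - (y - π / 2) ^ 2 / 2 ≤ Real.cos (y - π / 2) := Real.one_sub_sq_div_two_le_cos
    have hsy : Real.sin y = Real.cos (y - π / 2) := by
      rw [← Real.cos_pi_div_two_sub, ← Real.cos_neg, neg_sub]
    have h78 : 7 / 8 ≤ Real.sin y := by
      rw [hsy]
      nlinarith [sq_nonneg (y - π / 2)]
    rw [abs_of_nonneg (by linarith)]
    nlinarith

/-! ### Root factorisation of the norm -/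

/-- `‖Q(x)‖ = ‖lc Q‖ · ∏_{z ∈ roots Q} ‖x − z‖` over `ℂ`. -/
theorem cornerSL_norm_eval_eq (Q : ℂ[X]) (x : ℂ) :
    ‖Q.eval x‖ = ‖Q.leadingCoeff‖ * (Q.roots.map fun z => ‖x - z‖).prod := by
  have hnorm : ∀ s : Multiset ℂ, ‖s.prod‖ = (s.map fun z => ‖z‖).prod := fun s => by
    induction s using Multiset.induction_on with
    | empty => simp
    | cons a s ih => simp [ih]
  conv_lhs => rw [← C_leadingCoeff_mul_prod_multiset_X_sub_C (IsAlgClosed.card_roots_eq_natDegree (p := Q))]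
  rw [eval_mul, eval_C, norm_mul, eval_multiset_prod, hnorm, Multiset.map_map, Multiset.map_map]
  congr 2
  exact Multiset.map_congr rfl fun z _ => by simp only [Function.comp_apply, eval_sub, eval_X, eval_C]

/-! ### The doubling bound -/

/-- **Arc doubling (Remez-type) bound.**  For a complex polynomial `Q` of degree `≤ m`, a point `t⋆` of an
interval `[p, q]` of length `≤ 1`, the set of `t ∈ [p, q]` at which `‖Q(e^{it⋆})‖ ≤ (50m + 51)^m ‖Q(e^{it})‖`
has measure `≥ ¾ (q − p)`. -/
theorem cornerSL_arc_doubling (m : ℕ) (Q : ℂ[X]) (hQ : Q.natDegree ≤ m) {p q tstar : ℝ} (hpq : p ≤ q)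
    (hlen : q - p ≤ 1) (hts : tstar ∈ Icc p q) :
    ENNReal.ofReal (3 / 4 * (q - p)) ≤
      volume {t ∈ Icc p q | ‖Q.eval (exp (tstar * I))‖ ≤ (50 * m + 51 : ℝ) ^ m * ‖Q.eval (exp (t * I))‖} := by
  set ℓ := q - p with hℓ
  have hℓ0 : 0 ≤ ℓ := by rw [hℓ]; linarith
  -- phases of the roots, represented in `[p − π, p + π)`
  have hha := fun z : ℂ => cornerSL_half_angle z
  choose α₀ hα₀ using hha
  set α : ℂ → ℝ := fun z => toIcoMod Real.two_pi_pos (p - π) (α₀ z) with hαdef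
  have hαmem : ∀ z, α z ∈ Ico (p - π) (p - π + 2 * π) := fun z => toIcoMod_mem_Ico _ _ _
  have hαexp : ∀ z, exp (α z * I) = exp (α₀ z * I) := by
    intro z
    have h := self_sub_toIcoDiv_zsmul Real.two_pi_pos (p - π) (α₀ z)
    show exp (toIcoMod Real.two_pi_pos (p - π) (α₀ z) * I) = _
    rw [← h, zsmul_eq_mul]
    push_cast
    rw [sub_mul, exp_sub, show (↑(toIcoDiv Real.two_pi_pos (p - π) (α₀ z)) * (2 * ↑π) * I : ℂ) =
      ↑(toIcoDiv Real.two_pi_pos (p - π) (α₀ z)) * (2 * ↑π * I) by ring, exp_int_mul_two_pi_mul_I, div_one]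
  -- distance lower bound: for `t ∈ [p,q]` and any `z`: `|t - α z| ≤ 5 ‖exp(tI) - z‖`
  have hdist : ∀ z, ∀ t ∈ Icc p q, |t - α z| ≤ 5 * ‖exp (t * I) - z‖ := by
    intro z t ht
    have h1 : |t - α z| ≤ π + 1 := by
      obtain ⟨hz1, hz2⟩ := hαmem z
      rw [abs_le]
      constructor <;> linarith [ht.1, ht.2]
    have h2 := cornerSL_abs_le_five_mul_abs_sin_half h1
    have h3 : 2 * |Real.sin ((t - α z) / 2)| = ‖exp (t * I) - exp (α z * I)‖ :=
      (cornerSL_norm_cexp_sub_cexp_eq t (α z)).symm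
    have h4 : ‖exp (t * I) - exp (α z * I)‖ ≤ 2 * ‖exp (t * I) - z‖ := by rw [hαexp]; exact hα₀ z t
    linarith [abs_nonneg (Real.sin ((t - α z) / 2))]
  -- excluded neighbourhoods of the root phases
  set η : ℝ := ℓ / (10 * (m + 1)) with hη
  have hη0 : 0 ≤ η := by positivity
  set N : Set ℝ := ⋃ z ∈ Q.roots.toFinset, Icc (α z - η) (α z + η) with hN
  have hcard : (Q.roots.toFinset.card : ℝ) ≤ m := by
    have h1 : Q.roots.toFinset.card ≤ Q.roots.card := Multiset.toFinset_card_le _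
    rw [IsAlgClosed.card_roots_eq_natDegree] at h1
    exact_mod_cast h1.trans hQ
  have hNvol : volume N ≤ ENNReal.ofReal (ℓ / 5) := by
    calc volume N ≤ ∑ z ∈ Q.roots.toFinset, volume (Icc (α z - η) (α z + η)) := measure_biUnion_finset_le _ _
      _ = ∑ z ∈ Q.roots.toFinset, ENNReal.ofReal (2 * η) := by
          refine Finset.sum_congr rfl fun z _ => ?_
          rw [Real.volume_Icc]
          congr 1
          ring
      _ = (Q.roots.toFinset.card : ENNReal) * ENNReal.ofReal (2 * η) := by rw [Finset.sum_const, nsmul_eq_mul]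
      _ = ENNReal.ofReal (Q.roots.toFinset.card * (2 * η)) := by
          rw [← ENNReal.ofReal_natCast, ← ENNReal.ofReal_mul (by positivity)]
      _ ≤ ENNReal.ofReal (ℓ / 5) := by
          apply ENNReal.ofReal_le_ofReal
          have hm0 : (0 : ℝ) ≤ m := Nat.cast_nonneg m
          have : (m : ℝ) * (2 * η) ≤ ℓ / 5 := by
            rw [hη]
            rw [show (m : ℝ) * (2 * (ℓ / (10 * (m + 1)))) = ℓ / 5 * (m / (m + 1)) by field_simp; ring]
            have : (m : ℝ) / (m + 1) ≤ 1 := by rw [div_le_one (by positivity)]; linarith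
            nlinarith
          nlinarith
  -- the good set contains `[p, q] ∖ N`
  have hgood : Icc p q \ N ⊆
      {t ∈ Icc p q | ‖Q.eval (exp (tstar * I))‖ ≤ (50 * m + 51 : ℝ) ^ m * ‖Q.eval (exp (t * I))‖} := by
    rintro t ⟨ht, htN⟩
    refine ⟨ht, ?_⟩
    have hm0 : (0 : ℝ) ≤ m := Nat.cast_nonneg m
    -- per-root comparison
    have hroot : ∀ z ∈ Q.roots, ‖exp (tstar * I) - z‖ ≤ (50 * m + 51) * ‖exp (t * I) - z‖ := by
      intro z hz
      have hzN : η < |t - α z| := by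
        by_contra hcon
        push Not at hcon
        apply htN
        rw [hN]
        refine Set.mem_iUnion₂.2 ⟨z, Multiset.mem_toFinset.2 hz, ?_⟩
        rw [abs_le] at hcon
        constructor <;> linarith [hcon.1, hcon.2]
      have hd : |t - α z| ≤ 5 * ‖exp (t * I) - z‖ := hdist z t ht
      have htri : ‖exp (tstar * I) - z‖ ≤ ‖exp (t * I) - z‖ + |tstar - t| := by
        calc ‖exp (tstar * I) - z‖ = ‖(exp (t * I) - z) + (exp (tstar * I) - exp (t * I))‖ := by
              congr 1; ring
          _ ≤ ‖exp (t * I) - z‖ + ‖exp (tstar * I) - exp (t * I)‖ := norm_add_le _ _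
          _ ≤ ‖exp (t * I) - z‖ + |tstar - t| := by
              gcongr
              rw [cornerSL_norm_cexp_sub_cexp_eq]
              have h1 : |Real.sin ((tstar - t) / 2)| ≤ |(tstar - t) / 2| := Real.abs_sin_le_abs
              rw [abs_div, abs_two] at h1
              linarith
      have hδ : |tstar - t| ≤ ℓ := by
        rw [abs_le]
        constructor <;> linarith [ht.1, ht.2, hts.1, hts.2]
      have hℓη : ℓ = 10 * (m + 1) * η := by rw [hη]; field_simp
      have hkey : ℓ ≤ (50 * m + 50) * ‖exp (t * I) - z‖ := by
        rw [hℓη]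
        have : 10 * ((m : ℝ) + 1) * η ≤ 10 * (m + 1) * |t - α z| := by
          apply mul_le_mul_of_nonneg_left hzN.le; positivity
        nlinarith
      linarith [norm_nonneg (exp (t * I) - z)]
    -- products over the roots
    rw [cornerSL_norm_eval_eq, cornerSL_norm_eval_eq Q (exp (t * I))]
    have hprod : (Q.roots.map fun z => ‖exp (tstar * I) - z‖).prod ≤
        (Q.roots.map fun z => (50 * m + 51 : ℝ) * ‖exp (t * I) - z‖).prod :=
      Multiset.prod_map_le_prod_map₀ _ _ (fun z _ => norm_nonneg _) (fun z hz => hroot z hz)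
    rw [Multiset.prod_map_mul, Multiset.map_const', Multiset.prod_replicate,
      IsAlgClosed.card_roots_eq_natDegree] at hprod
    have hB1 : (1 : ℝ) ≤ 50 * m + 51 := by linarith
    have hBpow : (50 * m + 51 : ℝ) ^ Q.natDegree ≤ (50 * m + 51 : ℝ) ^ m := pow_le_pow_right₀ hB1 hQ
    have hP0 : 0 ≤ (Q.roots.map fun z => ‖exp (t * I) - z‖).prod :=
      Multiset.prod_nonneg fun x hx => by
        obtain ⟨z, _, rfl⟩ := Multiset.mem_map.1 hx
        exact norm_nonneg _
    calc ‖Q.leadingCoeff‖ * (Q.roots.map fun z => ‖exp (tstar * I) - z‖).prod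
        ≤ ‖Q.leadingCoeff‖ * ((50 * m + 51 : ℝ) ^ Q.natDegree * (Q.roots.map fun z => ‖exp (t * I) - z‖).prod) := by
          gcongr
      _ ≤ ‖Q.leadingCoeff‖ * ((50 * m + 51 : ℝ) ^ m * (Q.roots.map fun z => ‖exp (t * I) - z‖).prod) := by
          gcongr
      _ = (50 * m + 51 : ℝ) ^ m * (‖Q.leadingCoeff‖ * (Q.roots.map fun z => ‖exp (t * I) - z‖).prod) := by ring
  -- measure bookkeeping
  calc ENNReal.ofReal (3 / 4 * (q - p)) ≤ ENNReal.ofReal ℓ - ENNReal.ofReal (ℓ / 5) := by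
        rw [← ENNReal.ofReal_sub _ (by positivity)]
        apply ENNReal.ofReal_le_ofReal
        rw [hℓ]
        linarith
    _ ≤ volume (Icc p q) - volume N := by
        rw [Real.volume_Icc]
        exact tsub_le_tsub_left hNvol _
    _ ≤ volume (Icc p q \ N) := le_measure_sdiff
    _ ≤ _ := measure_mono hgood

end Summit.QuantumFields.QCD.Cruxes.WindowExtinction.CornerDecorrelationDeepHole
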